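import Mathlib.Data.Nat.Multiplicity
import Mathlib.Data.Nat.Choose.Lucas
import Mathlib.Data.Nat.Factorization.PrimePow
import Mathlib.RingTheory.Ideal.Operations
import Mathlib.RingTheory.PrincipalIdealDomain
import Mathlib.RingTheory.Int.Basic
import Mathlib.Algebra.EuclideanDomain.Int
import Mathlib.Algebra.Module.Basic
import HarnessLib

/-!
# Lazard's polynomials `C_n(X,Y) = ((X+Y)^n − X^n − Y^n)/ν(n)` and symmetric 2-cocycles (coefficient form)
# ([Lazard 1955] §II; [Hazewinkel 1978] §5.2; [Drinfeld 1974] §1)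

Topic `Literature/RingTheory/FormalGroups`; namespace `Literature.RingTheory.FormalGroups`.  DEFINITIONS + fully proved
theorems; no named fact, no instance, no notation, no `sorry`.  Cell `hodgecm-mathlib`, P6 «MOD programme», sub-line P6d
(Lubin–Tate formal moduli), input of LAZARD'S SYMMETRIC 2-COCYCLE LEMMA (sibling files `SymmetricCocycleField`,
`SymmetricCocycle`) and of DRINFELD'S KEY LEMMA (`DrinfeldCocycle`).

Everything here is elementary arithmetic of binomial coefficients, kept in COEFFICIENT FORM (functions `ℕ → M`), so that the
same statements serve power series over rings AND cochains with values in an arbitrary module: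

* `lazardNu n` — Lazard's `ν(n)`: the prime `ℓ` when `n = ℓ^k` (`k ≥ 1`), and `1` otherwise; `lazardNu n ∣ n.choose m` for
  `0 < m < n` (Kummer), `lazardNu_prime_pow`.
* `cocycleCoeff n m` — the coefficient of `X^m Y^{n−m}` in `C_n(X,Y) = ((X+Y)^n − X^n − Y^n)/ν(n)`, i.e. `n.choose m / ν(n)` for
  `0 < m < n` and `0` otherwise; `lazardNu n * cocycleCoeff n m = n.choose m`, symmetry.
* `IsSymmCocycle n a` — for `a : ℕ → M` (`M` an additive commutative monoid; `a m` = coefficient of `X^m Y^{n−m}` of a form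
  `Γ(X,Y)` of degree `n`): `Γ(X,Y) = Γ(Y,X)` and the 2-COCYCLE IDENTITY `Γ(Y,Z) + Γ(X,Y+Z) = Γ(X+Y,Z) + Γ(X,Y)` written out on
  the coefficient of `X^i Y^j Z^k` (`i+j+k = n`):
  `[i=0]·a j + (j+k).choose j • a i = (i+j).choose i • a (i+j) + [k=0]·a i`.  Closure under `0`, `+`, `•`, additive maps;
  consequences `a 0 = 0 = a n` (`n ≠ 0`) and LAZARD'S RELATION `m • a m = (n−1).choose (m−1) • a 1`.
* `isSymmCocycle_cocycleCoeff` — `C_n` itself is a symmetric 2-cocycle (it is the coboundary of `X^n`, divided by `ν(n)`).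
* PRIMITIVITY `exists_not_dvd_cocycleCoeff`: for `n ≥ 2` and every prime `ℓ` some `cocycleCoeff n m` (`0 < m < n`) is prime to
  `ℓ` (Kummer's exact valuation `v_ℓ (ℓ^k choose ℓ^{k−1}) = 1`; Lucas for `n = ℓ^a·m₀`), its BEZOUT FORM
  `exists_sum_mul_cocycleCoeff_eq_one` and the cancellation rule `eq_zero_of_cocycleCoeff_smul_eq_zero`
  (`(∀ m, cocycleCoeff n m • t = 0) → t = 0` in any additive commutative group).

Deliberately NOT here: the comparison lemma itself (siblings), the congruence `C_{p^k} ≡ C_p(X^{p^{k−1}},Y^{p^{k−1}}) (mod p)`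
(sibling `CocyclePolynomialFrobenius`), power series, formal group laws.
-/

namespace Literature.RingTheory.FormalGroups

open Finset

/-! ## §1 Lazard's `ν(n)` -/

/-- **Lazard's `ν(n)`**: the prime `ℓ` if `n = ℓ^k` is a prime power (`k ≥ 1`), and `1` otherwise; `C_n = B_n/ν(n)` is the
primitive integral multiple of `B_n(X,Y) = (X+Y)^n − X^n − Y^n`. [cite: Lazard1955, §II Lemme 3] -/
def lazardNu (n : ℕ) : ℕ := if IsPrimePow n then n.minFac else 1

/-- `ν(n) = 1` when `n` is not a prime power. [cite: Lazard1955, §II Lemme 3] -/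
theorem lazardNu_of_not_isPrimePow {n : ℕ} (h : ¬ IsPrimePow n) : lazardNu n = 1 := if_neg h

/-- `ν(ℓ^k) = ℓ` for `ℓ` prime and `k ≥ 1`. [cite: Lazard1955, §II Lemme 3] -/
theorem lazardNu_prime_pow {p k : ℕ} (hp : p.Prime) (hk : 0 < k) : lazardNu (p ^ k) = p := by
  rw [lazardNu, if_pos (hp.isPrimePow.pow hk.ne'), hp.pow_minFac hk.ne']

/-- `ν(ℓ) = ℓ` for `ℓ` prime. [cite: Lazard1955, §II Lemme 3] -/
theorem lazardNu_prime {p : ℕ} (hp : p.Prime) : lazardNu p = p := by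
  simpa using lazardNu_prime_pow hp Nat.one_pos

/-- `ν(n) ≥ 1`. [cite: Lazard1955, §II Lemme 3] -/
theorem lazardNu_pos (n : ℕ) : 0 < lazardNu n := by
  unfold lazardNu
  split_ifs with h
  · exact Nat.minFac_pos n
  · exact Nat.one_pos

/-- **Kummer**: `ν(n) ∣ (n choose m)` for `0 < m < n` (for `n = ℓ^k`, `ℓ` divides every inner binomial coefficient).
[cite: Lazard1955, §II Lemme 3] -/
theorem lazardNu_dvd_choose {n m : ℕ} (hm : 0 < m) (hmn : m < n) : lazardNu n ∣ n.choose m := by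
  by_cases h : IsPrimePow n
  · obtain ⟨p, k, hp, hk, rfl⟩ := (isPrimePow_nat_iff n).1 h
    rw [lazardNu_prime_pow hp hk]
    exact hp.dvd_choose_pow hm.ne' hmn.ne
  · rw [lazardNu_of_not_isPrimePow h]
    exact one_dvd _

/-! ## §2 The coefficients of `C_n` -/

/-- **The coefficients of Lazard's polynomial** `C_n(X,Y) = ((X+Y)^n − X^n − Y^n)/ν(n) = Σ_m cocycleCoeff n m · X^m Y^{n−m}`:
`cocycleCoeff n m = (n choose m)/ν(n)` for `0 < m < n`, and `0` otherwise (no `X^n`, `Y^n` terms). [cite: Lazard1955, §II Lemme 3] -/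
def cocycleCoeff (n m : ℕ) : ℕ := if 0 < m ∧ m < n then n.choose m / lazardNu n else 0

/-- `ν(n) · cocycleCoeff n m = n choose m` for `0 < m < n`. [cite: Lazard1955, §II Lemme 3] -/
theorem lazardNu_mul_cocycleCoeff {n m : ℕ} (hm : 0 < m) (hmn : m < n) :
    lazardNu n * cocycleCoeff n m = n.choose m := by
  rw [cocycleCoeff, if_pos ⟨hm, hmn⟩, Nat.mul_div_cancel' (lazardNu_dvd_choose hm hmn)]

/-- Outside `0 < m < n` the coefficient vanishes. [cite: Lazard1955, §II Lemme 3] -/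
theorem cocycleCoeff_of_not {n m : ℕ} (h : ¬ (0 < m ∧ m < n)) : cocycleCoeff n m = 0 := if_neg h

/-- `cocycleCoeff n 0 = 0` (no `Y^n` term). [cite: Lazard1955, §II Lemme 3] -/
@[simp] theorem cocycleCoeff_zero_right (n : ℕ) : cocycleCoeff n 0 = 0 := cocycleCoeff_of_not (by omega)

/-- `cocycleCoeff n m = 0` for `m ≥ n` (no `X^n` term, degree `n`). [cite: Lazard1955, §II Lemme 3] -/
theorem cocycleCoeff_eq_zero_of_le {n m : ℕ} (h : n ≤ m) : cocycleCoeff n m = 0 := cocycleCoeff_of_not (by omega)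

/-- Symmetry `cocycleCoeff n (n − m) = cocycleCoeff n m` (`C_n(X,Y) = C_n(Y,X)`). [cite: Lazard1955, §II Lemme 3] -/
theorem cocycleCoeff_symm {n m : ℕ} (h : m ≤ n) : cocycleCoeff n (n - m) = cocycleCoeff n m := by
  unfold cocycleCoeff
  by_cases hm : 0 < m ∧ m < n
  · rw [if_pos hm, if_pos (by omega), Nat.choose_symm h]
  · rw [if_neg hm, if_neg (by omega)]

/-- `cocycleCoeff 1 m = 0`: `C_1 = 0`. [cite: Lazard1955, §II Lemme 3] -/
@[simp] theorem cocycleCoeff_one_left (m : ℕ) : cocycleCoeff 1 m = 0 := cocycleCoeff_of_not (by omega)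

/-- `cocycleCoeff ℓ 1 = 1` for a prime `ℓ` (`C_ℓ = X^{ℓ−1}Y + …`). [cite: Lazard1955, §II Lemme 3] -/
theorem cocycleCoeff_prime_one {p : ℕ} (hp : p.Prime) : cocycleCoeff p 1 = 1 := by
  have h := lazardNu_mul_cocycleCoeff Nat.one_pos hp.one_lt
  rw [lazardNu_prime hp, Nat.choose_one_right] at h
  have : p * cocycleCoeff p 1 = p * 1 := by rw [h, mul_one]
  exact Nat.eq_of_mul_eq_mul_left hp.pos this

/-! ## §3 Symmetric 2-cocycles in coefficient form -/

/-- **Symmetric 2-cocycle of degree `n` with coefficients in `M`** (Lazard).  For `a : ℕ → M` read `a m` as the coefficient of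
`X^m Y^{n−m}` of a form `Γ(X,Y) = Σ_m a m · X^m Y^{n−m}`; then `Γ(X,Y) = Γ(Y,X)` is `symm`, and the 2-cocycle identity
`Γ(Y,Z) + Γ(X,Y+Z) = Γ(X+Y,Z) + Γ(X,Y)` compared on `X^i Y^j Z^k` (`i+j+k = n`) is `cocycle`:
`[i=0]·a j + (j+k choose j)·a i = (i+j choose i)·a (i+j) + [k=0]·a i`.  (`eq_zero_of_lt`: no coefficients beyond degree `n`.)
[cite: Lazard1955, §II Lemme 3] [cite: Hazewinkel1978, §5.2] -/
structure IsSymmCocycle {M : Type*} [AddCommMonoid M] (n : ℕ) (a : ℕ → M) : Prop where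
  /-- no coefficients in degree `> n` -/
  eq_zero_of_lt : ∀ m, n < m → a m = 0
  /-- `Γ(X,Y) = Γ(Y,X)` -/
  symm : ∀ m, m ≤ n → a (n - m) = a m
  /-- `Γ(Y,Z) + Γ(X,Y+Z) = Γ(X+Y,Z) + Γ(X,Y)` on the coefficient of `X^i Y^j Z^k` -/
  cocycle : ∀ i j k, i + j + k = n →
    (if i = 0 then a j else 0) + (j + k).choose j • a i = (i + j).choose i • a (i + j) + (if k = 0 then a i else 0)

namespace IsSymmCocycle

variable {M N : Type*} [AddCommMonoid M] [AddCommMonoid N] {n : ℕ} {a b : ℕ → M}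

/-- `0` is a symmetric 2-cocycle. [cite: Lazard1955, §II Lemme 3] -/
theorem zero (n : ℕ) : IsSymmCocycle n (fun _ => (0 : M)) where
  eq_zero_of_lt := fun _ _ => rfl
  symm := fun _ _ => rfl
  cocycle := fun i j k _ => by simp

/-- Sums of symmetric 2-cocycles are symmetric 2-cocycles. [cite: Lazard1955, §II Lemme 3] -/
theorem add (ha : IsSymmCocycle n a) (hb : IsSymmCocycle n b) : IsSymmCocycle n (fun m => a m + b m) where
  eq_zero_of_lt := fun m hm => by rw [ha.eq_zero_of_lt m hm, hb.eq_zero_of_lt m hm, add_zero]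
  symm := fun m hm => by rw [ha.symm m hm, hb.symm m hm]
  cocycle := fun i j k h => by
    have h1 := ha.cocycle i j k h
    have h2 := hb.cocycle i j k h
    have e1 : (if i = 0 then a j + b j else (0 : M)) = (if i = 0 then a j else 0) + (if i = 0 then b j else 0) := by
      split_ifs <;> simp
    have e2 : (if k = 0 then a i + b i else (0 : M)) = (if k = 0 then a i else 0) + (if k = 0 then b i else 0) := by
      split_ifs <;> simp
    rw [e1, e2, smul_add, smul_add]
    calc _ = ((if i = 0 then a j else 0) + (j + k).choose j • a i)
          + ((if i = 0 then b j else 0) + (j + k).choose j • b i) := by abel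
      _ = _ := by rw [h1, h2]; abel

/-- Scalar multiples of symmetric 2-cocycles are symmetric 2-cocycles. [cite: Lazard1955, §II Lemme 3] -/
theorem smul {R : Type*} [Monoid R] [DistribMulAction R M] (r : R) (ha : IsSymmCocycle n a) :
    IsSymmCocycle n (fun m => r • a m) where
  eq_zero_of_lt := fun m hm => by rw [ha.eq_zero_of_lt m hm, smul_zero]
  symm := fun m hm => by rw [ha.symm m hm]
  cocycle := fun i j k h => by
    have h1 := congrArg (r • ·) (ha.cocycle i j k h)
    split_ifs at h1 ⊢ <;> simp only [smul_add, zero_add, add_zero, smul_comm r] at h1 ⊢ <;> exact h1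

/-- The image of a symmetric 2-cocycle under an additive map is one. [cite: Lazard1955, §II Lemme 3] -/
theorem map {F : Type*} [FunLike F M N] [AddMonoidHomClass F M N] (f : F) (ha : IsSymmCocycle n a) :
    IsSymmCocycle n (fun m => f (a m)) where
  eq_zero_of_lt := fun m hm => by rw [ha.eq_zero_of_lt m hm, map_zero]
  symm := fun m hm => by rw [ha.symm m hm]
  cocycle := fun i j k h => by
    have h1 := congrArg f (ha.cocycle i j k h)
    split_ifs at h1 ⊢ <;> simp only [map_add, map_nsmul, zero_add, add_zero] at h1 ⊢ <;> exact h1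

/-- A symmetric 2-cocycle is determined through an INJECTIVE additive map: if `f ∘ b` is one, so is `b`.
[cite: Lazard1955, §II Lemme 3] -/
theorem of_map_injective {F : Type*} [FunLike F M N] [AddMonoidHomClass F M N] (f : F)
    (hf : Function.Injective f) (h : IsSymmCocycle n (fun m => f (b m))) : IsSymmCocycle n b where
  eq_zero_of_lt := fun m hm => hf (by rw [h.eq_zero_of_lt m hm, map_zero])
  symm := fun m hm => hf (h.symm m hm)
  cocycle := fun i j k hijk => hf (by
    have h1 := h.cocycle i j k hijk
    split_ifs at h1 ⊢ <;> simp only [map_add, map_nsmul, zero_add, add_zero] at h1 ⊢ <;> exact h1)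

/-- Differences of symmetric 2-cocycles (coefficients in an additive commutative group) are symmetric 2-cocycles.
[cite: Lazard1955, §II Lemme 3] -/
theorem sub {G : Type*} [AddCommGroup G] {a b : ℕ → G} (ha : IsSymmCocycle n a) (hb : IsSymmCocycle n b) :
    IsSymmCocycle n (fun m => a m - b m) := by
  have h := ha.add (hb.smul (-1 : ℤ))
  simpa [sub_eq_add_neg] using h

end IsSymmCocycle

namespace IsSymmCocycle

variable {M : Type*} [AddCancelCommMonoid M] {n : ℕ} {a : ℕ → M}

/-- `a 0 = 0` for a symmetric 2-cocycle of degree `n ≠ 0` (coefficient of `Z^n`: `2·a 0 = a 0`). [cite: Lazard1955, §II Lemme 3] -/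
theorem apply_zero (ha : IsSymmCocycle n a) (hn : n ≠ 0) : a 0 = 0 := by
  have h := ha.cocycle 0 0 n (by omega)
  simp only [↓reduceIte, Nat.choose_zero_right, one_smul, zero_add, hn, add_zero] at h
  -- h : a 0 + a 0 = a 0
  nth_rw 3 [← add_zero (a 0)] at h
  exact add_left_cancel h

/-- `a n = 0` for a symmetric 2-cocycle of degree `n ≠ 0` (by symmetry). [cite: Lazard1955, §II Lemme 3] -/
theorem apply_self (ha : IsSymmCocycle n a) (hn : n ≠ 0) : a n = 0 := by
  have h := ha.symm n le_rfl
  rw [Nat.sub_self, ha.apply_zero hn] at h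
  exact h.symm

/-- The inner relations: `(j+k choose j)·a i = (i+j choose i)·a (i+j)` for `i, k ≥ 1`, `i+j+k = n`.
[cite: Lazard1955, §II Lemme 3] -/
theorem choose_smul_eq (ha : IsSymmCocycle n a) {i j k : ℕ} (h : i + j + k = n) (hi : i ≠ 0) (hk : k ≠ 0) :
    (j + k).choose j • a i = (i + j).choose i • a (i + j) := by
  have h1 := ha.cocycle i j k h
  simpa [hi, hk] using h1

/-- **Lazard's relation** `m·a m = (n−1 choose m−1)·a 1` for `1 ≤ m ≤ n−1` (the inner relation at `(1, m−1, n−m)`).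
[cite: Lazard1955, §II Lemme 3] -/
theorem self_smul_eq (ha : IsSymmCocycle n a) {m : ℕ} (hm : 0 < m) (hmn : m < n) :
    m • a m = (n - 1).choose (m - 1) • a 1 := by
  have h := ha.choose_smul_eq (i := 1) (j := m - 1) (k := n - m) (by omega) one_ne_zero (by omega)
  rw [show m - 1 + (n - m) = n - 1 by omega, show 1 + (m - 1) = m by omega, Nat.choose_one_right] at h
  exact h.symm

end IsSymmCocycle

/-! ## §4 `C_n` is a symmetric 2-cocycle -/

/-- The binomial identity behind the cocycle property of `C_n`: `(j+k choose j)(n choose i) = (i+j choose i)(n choose i+j)`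
for `i+j+k = n` (both sides are the trinomial coefficient `n!/(i!j!k!)`) (private helper). [folklore] -/
private theorem choose_mul_choose_eq_of_add {i j k n : ℕ} (h : i + j + k = n) :
    (j + k).choose j * n.choose i = (i + j).choose i * n.choose (i + j) := by
  have hc := Nat.choose_mul (n := n) (k := i + j) (s := i) (Nat.le_add_right i j)
  rw [show i + j - i = j by omega, show n - i = j + k by omega] at hc
  -- hc : n.choose (i+j) * (i+j).choose i = n.choose i * (j+k).choose j
  rw [mul_comm ((j + k).choose j), ← hc, mul_comm]

/-- **`C_n(X,Y)` is a symmetric 2-cocycle** (with coefficients in `ℕ`): it is `(δX^n)/ν(n)`, the coboundary of `X^n` divided by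
`ν(n)`. [cite: Lazard1955, §II Lemme 3] -/
theorem isSymmCocycle_cocycleCoeff (n : ℕ) : IsSymmCocycle n (cocycleCoeff n) where
  eq_zero_of_lt := fun m hm => cocycleCoeff_eq_zero_of_le hm.le
  symm := fun m hm => cocycleCoeff_symm hm
  cocycle := fun i j k h => by
    by_cases hi : i = 0
    · subst hi
      simp
    by_cases hk : k = 0
    · subst hk
      have : cocycleCoeff n (i + j) = 0 := cocycleCoeff_eq_zero_of_le (by omega)
      simp [hi, this]
    simp only [hi, ↓reduceIte, smul_eq_mul, zero_add, hk, add_zero]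
    apply Nat.eq_of_mul_eq_mul_left (lazardNu_pos n)
    rw [mul_left_comm, lazardNu_mul_cocycleCoeff (by omega) (by omega), mul_left_comm,
      lazardNu_mul_cocycleCoeff (by omega) (by omega), choose_mul_choose_eq_of_add h]

/-- Scalar form: for every `t : M`, `m ↦ cocycleCoeff n m • t` is a symmetric 2-cocycle of degree `n`. [cite: Lazard1955, §II Lemme 3] -/
theorem isSymmCocycle_cocycleCoeff_smul {M : Type*} [AddCommMonoid M] (n : ℕ) (t : M) :
    IsSymmCocycle n (fun m => cocycleCoeff n m • t) := by
  have h := (isSymmCocycle_cocycleCoeff n).map (smulAddHom ℕ M |>.flip t)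
  simpa using h

/-! ## §5 Primitivity of `C_n` -/

/-- Lucas, iterated: `(ℓ^a·x choose ℓ^a·y) ≡ (x choose y) (mod ℓ)` (private helper). [folklore] -/
private theorem choose_pow_mul_pow_mul_modEq {ℓ : ℕ} (hℓ : ℓ.Prime) (a x y : ℕ) :
    (ℓ ^ a * x).choose (ℓ ^ a * y) ≡ x.choose y [MOD ℓ] := by
  haveI := Fact.mk hℓ
  induction a with
  | zero => simp [Nat.ModEq.refl]
  | succ a ih =>
    rw [pow_succ, mul_comm (ℓ ^ a) ℓ, mul_assoc, mul_assoc]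
    exact (Choose.choose_mul_mul_modEq_choose_nat).trans ih

/-- **Primitivity of `C_n`** (`n ≥ 2`): for every prime `ℓ` some coefficient `cocycleCoeff n m`, `0 < m < n`, is prime to `ℓ`.
Cases: `n = ℓ^k` — `m = ℓ^{k−1}`, Kummer's `v_ℓ(ℓ^k choose ℓ^{k−1}) = 1`; `n = q^k`, `q ≠ ℓ` — `m = 1`, coefficient `q^{k−1}`;
`n` not a prime power, `ℓ ∤ n` — `m = 1`, coefficient `n`; `n = ℓ^a m₀`, `ℓ ∤ m₀ > 1` — `m = ℓ^a`, Lucas.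
[cite: Lazard1955, §II Lemme 3] [cite: Hazewinkel1978, §5.2] -/
theorem exists_not_dvd_cocycleCoeff {n ℓ : ℕ} (hn : 2 ≤ n) (hℓ : ℓ.Prime) :
    ∃ m, 0 < m ∧ m < n ∧ ¬ ℓ ∣ cocycleCoeff n m := by
  by_cases hpp : IsPrimePow n
  · obtain ⟨q, k, hq, hk, rfl⟩ := (isPrimePow_nat_iff n).1 hpp
    have hν : lazardNu (q ^ k) = q := lazardNu_prime_pow hq hk
    by_cases hql : q = ℓ
    · subst hql
      refine ⟨q ^ (k - 1), pow_pos hq.pos _, Nat.pow_lt_pow_right hq.one_lt (by omega), fun hdvd => ?_⟩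
      have hm0 : 0 < q ^ (k - 1) := pow_pos hq.pos _
      have hmn : q ^ (k - 1) < q ^ k := Nat.pow_lt_pow_right hq.one_lt (by omega)
      have hmul := lazardNu_mul_cocycleCoeff hm0 hmn
      rw [hν] at hmul
      have hem := hq.emultiplicity_choose_prime_pow hmn.le hm0.ne'
      rw [multiplicity_pow_self_of_prime hq.prime, show k - (k - 1) = 1 by omega] at hem
      have h2 : ¬ q ^ 2 ∣ (q ^ k).choose (q ^ (k - 1)) := by
        have := (emultiplicity_eq_coe.1 hem).2
        simpa using this
      apply h2
      rw [← hmul, pow_two]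
      exact Nat.mul_dvd_mul_left q hdvd
    · refine ⟨1, Nat.one_pos, hn, fun hdvd => hql ?_⟩
      have hmul := lazardNu_mul_cocycleCoeff Nat.one_pos (show 1 < q ^ k from hn)
      rw [hν, Nat.choose_one_right] at hmul
      have hc : cocycleCoeff (q ^ k) 1 = q ^ (k - 1) := by
        apply Nat.eq_of_mul_eq_mul_left hq.pos
        rw [hmul, ← pow_succ', show k - 1 + 1 = k by omega]
      rw [hc] at hdvd
      exact ((Nat.prime_dvd_prime_iff_eq hℓ hq).1 (hℓ.dvd_of_dvd_pow hdvd)).symm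
  · have hν : lazardNu n = 1 := lazardNu_of_not_isPrimePow hpp
    by_cases hln : ℓ ∣ n
    · have hn0 : n ≠ 0 := by omega
      set a := n.factorization ℓ with ha
      set m₀ := n / ℓ ^ a with hm₀
      have hdecomp : ℓ ^ a * m₀ = n := Nat.ordProj_mul_ordCompl_eq_self n ℓ
      have hm₀ndvd : ¬ ℓ ∣ m₀ := Nat.not_dvd_ordCompl hℓ hn0
      have ha0 : 0 < a := hℓ.factorization_pos_of_dvd hn0 hln
      have hm₀1 : 1 < m₀ := by
        rcases Nat.lt_or_ge 1 m₀ with h | h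
        · exact h
        · exfalso
          have hm₀0 : m₀ ≠ 0 := fun h0 => by rw [h0, mul_zero] at hdecomp; exact hn0 hdecomp.symm
          have : m₀ = 1 := le_antisymm h (Nat.pos_of_ne_zero hm₀0)
          rw [this, mul_one] at hdecomp
          exact hpp (hdecomp ▸ hℓ.isPrimePow.pow ha0.ne')
      have hmn : ℓ ^ a < n := by
        calc ℓ ^ a = ℓ ^ a * 1 := (mul_one _).symm
          _ < ℓ ^ a * m₀ := Nat.mul_lt_mul_of_pos_left hm₀1 (pow_pos hℓ.pos _)
          _ = n := hdecomp
      refine ⟨ℓ ^ a, pow_pos hℓ.pos _, hmn, fun hdvd => hm₀ndvd ?_⟩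
      have hmul := lazardNu_mul_cocycleCoeff (pow_pos hℓ.pos a) hmn
      rw [hν, one_mul] at hmul
      rw [hmul] at hdvd
      have hluc := choose_pow_mul_pow_mul_modEq hℓ a m₀ 1
      rw [mul_one, hdecomp, Nat.choose_one_right] at hluc
      exact (hluc.dvd_iff dvd_rfl).1 hdvd
    · refine ⟨1, Nat.one_pos, hn, fun hdvd => hln ?_⟩
      have hmul := lazardNu_mul_cocycleCoeff Nat.one_pos (show 1 < n from hn)
      rw [hν, one_mul, Nat.choose_one_right] at hmul
      rwa [hmul] at hdvd

/-- **Bezout form of primitivity**: for `n ≥ 2` there are integers `w m` with `Σ_{m<n} w m · cocycleCoeff n m = 1`.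
[cite: Lazard1955, §II Lemme 3] -/
theorem exists_sum_mul_cocycleCoeff_eq_one {n : ℕ} (hn : 2 ≤ n) :
    ∃ w : ℕ → ℤ, ∑ m ∈ range n, w m * (cocycleCoeff n m : ℤ) = 1 := by
  classical
  let I : Ideal ℤ := Ideal.span (Set.range fun m : Fin n => (cocycleCoeff n m : ℤ))
  have hI : I = ⊤ := by
    by_contra hne
    obtain ⟨P, hP, hIP⟩ := Ideal.exists_le_maximal I hne
    set g : ℤ := Submodule.IsPrincipal.generator P with hg
    have hgP : P = Ideal.span {g} := (Ideal.span_singleton_generator P).symm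
    have hmem : ∀ m, m < n → g ∣ (cocycleCoeff n m : ℤ) := fun m hmn => by
      have : (cocycleCoeff n m : ℤ) ∈ P := hIP (Ideal.subset_span ⟨⟨m, hmn⟩, rfl⟩)
      rw [hgP, Ideal.mem_span_singleton] at this
      exact this
    by_cases hg0 : g = 0
    · obtain ⟨m, -, hmn, hndvd⟩ := exists_not_dvd_cocycleCoeff hn Nat.prime_two
      have h0 := hmem m hmn
      rw [hg0, zero_dvd_iff, Nat.cast_eq_zero] at h0
      exact hndvd (h0 ▸ dvd_zero 2)
    · have hgprime : Prime g := (Ideal.span_singleton_prime hg0).1 (hgP ▸ hP.isPrime)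
      have hℓ : (g.natAbs).Prime := Int.prime_iff_natAbs_prime.1 hgprime
      obtain ⟨m, -, hmn, hndvd⟩ := exists_not_dvd_cocycleCoeff hn hℓ
      exact hndvd (by simpa using Int.natAbs_dvd_natAbs.2 (hmem m hmn))
  have h1 : (1 : ℤ) ∈ I := hI ▸ Submodule.mem_top
  obtain ⟨w, hw⟩ := Ideal.mem_span_range_iff_exists_fun.1 h1
  refine ⟨fun m => if h : m < n then w ⟨m, h⟩ else 0, ?_⟩
  rw [← hw, ← Fin.sum_univ_eq_sum_range (fun m => (if h : m < n then w ⟨m, h⟩ else 0) * (cocycleCoeff n m : ℤ))]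
  refine Finset.sum_congr rfl fun i _ => ?_
  simp [i.isLt]

/-- **Cancellation rule**: in an additive commutative group, `cocycleCoeff n m • t = 0` for all `0 < m < n` forces `t = 0`
(`n ≥ 2`; by the Bezout form of primitivity).  In particular the scalar `t` with `Γ = C_n·t` is unique. [cite: Lazard1955, §II Lemme 3] -/
theorem eq_zero_of_cocycleCoeff_smul_eq_zero {M : Type*} [AddCommGroup M] {n : ℕ} (hn : 2 ≤ n) {t : M}
    (h : ∀ m, 0 < m → m < n → cocycleCoeff n m • t = 0) : t = 0 := by
  obtain ⟨w, hw⟩ := exists_sum_mul_cocycleCoeff_eq_one hn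
  have : (∑ m ∈ range n, w m * (cocycleCoeff n m : ℤ)) • t = 0 := by
    rw [Finset.sum_smul]
    refine Finset.sum_eq_zero fun m hm => ?_
    rw [mul_smul, natCast_zsmul]
    rcases Nat.eq_zero_or_pos m with rfl | hm0
    · rw [cocycleCoeff_zero_right, zero_smul, smul_zero]
    · rw [h m hm0 (Finset.mem_range.1 hm), smul_zero]
  rwa [hw, one_smul] at this

end Literature.RingTheory.FormalGroups
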